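import Mathlib
import HarnessLib
import Summits.NavierStokesRegularity.NavierStokesRegularity.Theorems.CompletionRelayChainPhaseISoundDist
import Summits.NavierStokesRegularity.NavierStokesRegularity.Theorems.CompletionRelayChainRelayFrontStepEnergyIncrement

/-!
# Route `CompletionRelayChain` — crux `RelayFrontStep` (stmt-NavierStokesRegularity-24850), K-side of `stub_phaseI`,
  work package K5-k: THE SHELL-2 ENERGY BOUND `Shell2Bound` (energy identity + Gronwall)

Along a pseudo-flow, for an active mode `j` of old shell `2`: `F(t) − F(0) ≤ ∫₀ᵗ q·S` ((4.9)), `q·S = S'·S − (S' − q)·S`,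
`∫₀ᵗ S'S = ½S(t)² − ½S(0)²` (FTC), `|S' − q|·|S| ≤ 16κ₁√F·√(2F) = 16√2κ₁F` ((4.8) at `k = 2` and (4.10)); hence
`F(t) ≤ F₀ + ½M² + 16√2κ₁∫₀ᵗF` whenever `|S| ≤ M` on `[0,t]`, and Gronwall gives `F(t) ≤ (F₀ + ½M²)·e^{16√2κ₁t}`,
`e^{16√2κ₁·147/64} ≤ 1 + 2^{-18}`.  MODEL-lattice bookkeeping (rung TL-M3-R64); nothing here is a statement about the
Navier–Stokes equations.
-/

noncomputable section

set_option linter.dupNamespace false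

namespace Summit.NavierStokesRegularity.NavierStokesRegularity.Cruxes.RelayFrontStep.PhaseI

open Set MeasureTheory intervalIntegral
open Literature.Analysis.FluidPDE.TaoCascade

variable {α : Fin 4 → Fin 4 → Fin 4 → ℤ × ℤ × ℤ → ℝ} {τ : ℝ} {S₀ F₀ B₀ : Fin 4 → ℤ → ℝ} {S F : Fin 4 → ℤ → ℝ → ℝ}

/-- The Gronwall rate `c = 16√2·κ₁`. [this file] -/
def cG : ℝ := 16 * Real.sqrt 2 * (1 / 10 ^ 8)

/-- `0 ≤ c`. [this file] -/
theorem cG_nonneg : 0 ≤ cG := by unfold cG; positivity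

/-- `e^{c·147/64} ≤ 1 + 2^{-18}`. [this file] -/
theorem exp_cG_le : Real.exp (cG * (147 / 64)) ≤ 1 + 1 / 2 ^ 18 := by
  have hs := sqrt_two_le
  have hx0 : 0 ≤ cG * (147 / 64) := mul_nonneg cG_nonneg (by norm_num)
  have hx1 : cG * (147 / 64) ≤ 6 / 10 ^ 7 := by
    unfold cG
    have : Real.sqrt 2 ≤ 3 / 2 := hs.trans (by norm_num)
    nlinarith [Real.sqrt_nonneg 2]
  have hb := Real.exp_bound (x := cG * (147 / 64)) (by rw [abs_of_nonneg hx0]; linarith) (n := 1) Nat.one_pos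
  simp only [Finset.range_one, Finset.sum_singleton, pow_zero, Nat.factorial_zero, Nat.cast_one, div_one,
    pow_one, Nat.factorial_one, Nat.succ_eq_add_one, mul_one] at hb
  rw [abs_of_nonneg hx0] at hb
  have := (abs_le.1 hb).2
  norm_num at this ⊢
  nlinarith

/-- **The integral inequality**: `F_{j,2}(t) ≤ F₀_{j,2} + ½M² + c∫₀ᵗ F_{j,2}` when `|S_{j,2}| ≤ M` on `[0,t]`. [this file] -/
theorem shell2_integral_ineq (H : Hyps α τ S₀ F₀ B₀ S F) (j : Fin 4) {t M : ℝ} (ht0 : 0 ≤ t) (htτ : t < τ)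
    (hM : ∀ r ∈ Icc (0:ℝ) t, |S j 2 r| ≤ M) :
    F j 2 t ≤ F₀ j 2 + M ^ 2 / 2 + cG * ∫ u in (0:ℝ)..t, F j 2 u := by
  have hτ : 0 < τ := lt_of_le_of_lt ht0 htτ
  set X : ℝ → ℝ := S j 2 with hX
  set G : ℝ → ℝ := F j 2 with hGdef
  set X' : ℝ → ℝ := fun s => derivWithin X (Icc 0 τ) s with hX'
  set q : ℝ → ℝ := fun s => quadTerm 1 α S j 2 s with hq
  have hcX : ContDiffOn ℝ 1 X (Icc 0 τ) := H.hflow.contDiffOn_S j 2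
  have hcG : ContDiffOn ℝ 1 G (Icc 0 τ) := H.hflow.contDiffOn_F j 2
  have hXc : ContinuousOn X (Icc 0 τ) := hcX.continuousOn
  have hGc : ContinuousOn G (Icc 0 τ) := hcG.continuousOn
  have hX'c : ContinuousOn X' (Icc 0 τ) := hcX.continuousOn_derivWithin (uniqueDiffOn_Icc hτ) le_rfl
  have hsub : Icc (0:ℝ) t ⊆ Icc 0 τ := Icc_subset_Icc_right htτ.le
  -- (4.9): F(t) − F(0) ≤ ∫ q·X
  have hinc := Summit.NavierStokesRegularity.NavierStokesRegularity.Theorems.RelayFrontStep.pseudoFlowOn_energy_increment_le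
    H.hflow hτ j 2 (s := 0) (t := t) le_rfl ht0 htτ.le
  have hqXc := Summit.NavierStokesRegularity.NavierStokesRegularity.Theorems.RelayFrontStep.pseudoFlowOn_continuousOn_quadTerm_mul
    H.hflow j 2
  -- FTC: ∫ X'·X = ½X(t)² − ½X(0)²
  have hderX : ∀ x ∈ Ioo (0:ℝ) t, HasDerivAt X (X' x) x := by
    intro x hx
    have hxI : x ∈ Icc (0:ℝ) τ := ⟨hx.1.le, (hx.2.trans htτ).le⟩
    have hd : DifferentiableWithinAt ℝ X (Icc 0 τ) x := (hcX.differentiableOn one_ne_zero) x hxI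
    exact hd.hasDerivWithinAt.hasDerivAt (Icc_mem_nhds hx.1 (hx.2.trans htτ))
  have hftc : ∫ u in (0:ℝ)..t, X' u * X u = X t ^ 2 / 2 - X 0 ^ 2 / 2 := by
    have h := integral_eq_sub_of_hasDeriv_right_of_le ht0 (f := fun s => X s ^ 2 / 2) (f' := fun u => X' u * X u)
      ((hXc.mono hsub).pow 2 |>.div_const 2)
      (fun x hx => by
        have h1 := ((hderX x hx).pow 2).div_const 2
        have e : (2 : ℕ) * X x ^ (2 - 1) * X' x / 2 = X' x * X x := by ring
        rw [e] at h1
        exact h1.hasDerivWithinAt)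
      (((hX'c.mono hsub).mul (hXc.mono hsub)).intervalIntegrable_of_Icc ht0)
    exact h
  -- pointwise: q·X = X'X − (X'−q)X and |(X'−q)X| ≤ c·G
  have hpt : ∀ u ∈ Icc (0:ℝ) t, q u * X u ≤ X' u * X u + cG * G u := by
    intro u hu
    have huτ : u ∈ Icc (0:ℝ) τ := hsub hu
    have hm := H.hflow.motion j 2 u huτ
    have hl := H.hflow.defect_lower j 2 u huτ
    have hG0 := H.hflow.nonneg_F j 2 u huτ
    have e16 : (1 + 1 : ℝ) ^ ((2 : ℝ) * ((2 : ℤ) : ℝ)) = 16 := by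
      rw [show (2 : ℝ) * ((2 : ℤ) : ℝ) = ((4 : ℕ) : ℝ) by norm_num, Real.rpow_natCast]; norm_num
    rw [e16] at hm
    have hXabs : |X u| ≤ Real.sqrt 2 * Real.sqrt (G u) := by
      rw [← Real.sqrt_mul (by norm_num), ← Real.sqrt_sq_eq_abs]
      exact Real.sqrt_le_sqrt (by rw [hX, hGdef]; linarith)
    have hd : |X' u - q u| ≤ 1 / 10 ^ 8 * 16 * Real.sqrt (G u) := by simpa [hX', hq, hX, hGdef] using hm
    have hprod : |(X' u - q u) * X u| ≤ cG * G u := by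
      rw [abs_mul]
      calc |X' u - q u| * |X u| ≤ (1 / 10 ^ 8 * 16 * Real.sqrt (G u)) * (Real.sqrt 2 * Real.sqrt (G u)) :=
            mul_le_mul hd hXabs (abs_nonneg _) (by positivity)
        _ = cG * (Real.sqrt (G u) * Real.sqrt (G u)) := by unfold cG; ring
        _ = cG * G u := by rw [Real.mul_self_sqrt hG0]
    have := neg_abs_le ((X' u - q u) * X u)
    nlinarith [abs_nonneg ((X' u - q u) * X u)]
  -- integrate the pointwise inequality
  have hiq : IntervalIntegrable (fun u => q u * X u) volume 0 t := (hqXc.mono hsub).intervalIntegrable_of_Icc ht0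
  have hiX : IntervalIntegrable (fun u => X' u * X u) volume 0 t :=
    ((hX'c.mono hsub).mul (hXc.mono hsub)).intervalIntegrable_of_Icc ht0
  have hiG : IntervalIntegrable (fun u => G u) volume 0 t := (hGc.mono hsub).intervalIntegrable_of_Icc ht0
  have hint : (∫ u in (0:ℝ)..t, q u * X u) ≤ ∫ u in (0:ℝ)..t, (X' u * X u + cG * G u) :=
    integral_mono_on ht0 hiq (hiX.add (hiG.const_mul cG)) fun u hu => hpt u hu
  rw [integral_add hiX (hiG.const_mul cG), intervalIntegral.integral_const_mul, hftc] at hint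
  -- assemble
  have hXt : X t ^ 2 ≤ M ^ 2 := by
    have h1 := hM t ⟨ht0, le_rfl⟩
    have hMn : 0 ≤ M := (abs_nonneg _).trans h1
    rw [hX] at h1 ⊢
    nlinarith [abs_nonneg (S j 2 t), sq_abs (S j 2 t)]
  have hF0 : G 0 = F₀ j 2 := H.hflow.init_F j 2
  have hX0 : 0 ≤ X 0 ^ 2 / 2 := by positivity
  have hG : G t - G 0 ≤ ∫ u in (0:ℝ)..t, q u * X u := hinc
  rw [hGdef] at hG hF0 hint
  linarith

/-- **`Shell2Bound` holds along every pseudo-flow satisfying the hypotheses of `stub_phaseI`.** [this file] -/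
theorem shell2Bound (H : Hyps α τ S₀ F₀ B₀ S F) : Shell2Bound F₀ S F := by
  intro i t ht0 htT M hM
  set j := blockMode i with hj
  have hτ8 := H.hτ
  have htτ : t < τ := lt_of_le_of_lt htT (by linarith)
  have hτ : 0 < τ := by linarith
  -- constants
  set A : ℝ := F₀ j 2 + M ^ 2 / 2 with hA
  have hF00 : 0 ≤ F₀ j 2 := by
    have := H.hflow.nonneg_F j 2 0 ⟨le_rfl, hτ.le⟩; rwa [H.hflow.init_F] at this
  have hA0 : 0 ≤ A := by positivity
  -- continuous extension of G = F j 2 to ℝ by clamping the argument to [0, τ]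
  set G : ℝ → ℝ := F j 2 with hGdef
  have hGc : ContinuousOn G (Icc 0 τ) := (H.hflow.contDiffOn_F j 2).continuousOn
  set Gx : ℝ → ℝ := fun s => G (max 0 (min s τ)) with hGx
  have hclamp : Continuous fun s : ℝ => max 0 (min s τ) := continuous_const.max (continuous_id.min continuous_const)
  have hclampI : ∀ s, max 0 (min s τ) ∈ Icc (0:ℝ) τ := fun s =>
    ⟨le_max_left _ _, max_le hτ.le (min_le_right _ _)⟩
  have hGxc : Continuous Gx := hGc.comp_continuous hclamp hclampI
  have hGx_eq : ∀ s ∈ Icc (0:ℝ) τ, Gx s = G s := fun s hs => by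
    simp only [hGx]; rw [min_eq_left hs.2, max_eq_right hs.1]
  have hInt_eq : ∀ x ∈ Icc (0:ℝ) t, (∫ u in (0:ℝ)..x, Gx u) = ∫ u in (0:ℝ)..x, G u := by
    intro x hx
    refine integral_congr fun u hu => ?_
    rw [uIcc_of_le hx.1] at hu
    exact hGx_eq u ⟨hu.1, hu.2.trans (hx.2.trans htτ.le)⟩
  -- Φ(s) = A + c ∫₀ˢ Gx
  set Φ : ℝ → ℝ := fun s => A + cG * ∫ u in (0:ℝ)..s, Gx u with hΦ
  have hΦder : ∀ x, HasDerivAt Φ (cG * Gx x) x := fun x => by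
    have h := (hGxc.integral_hasStrictDerivAt 0 x).hasDerivAt
    exact (h.const_mul cG).const_add A
  have hΦc : ContinuousOn Φ (Icc 0 t) := fun x _ => (hΦder x).continuousAt.continuousWithinAt
  -- G ≤ Φ on [0, t]
  have hGΦ : ∀ x ∈ Icc (0:ℝ) t, G x ≤ Φ x := by
    intro x hx
    have h := shell2_integral_ineq H j hx.1 (lt_of_le_of_lt hx.2 htτ) (M := M)
      (fun r hr => hM r ⟨hr.1, hr.2.trans hx.2⟩)
    simp only [hΦ]; rw [hInt_eq x hx, hA]; exact h
  have hG0 : ∀ x ∈ Icc (0:ℝ) t, 0 ≤ G x := fun x hx => H.hflow.nonneg_F j 2 x ⟨hx.1, hx.2.trans htτ.le⟩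
  -- Gronwall
  have hgr := norm_le_gronwallBound_of_norm_deriv_right_le (f := Φ) (f' := fun x => cG * Gx x) (δ := A) (K := cG)
    (ε := 0) (a := 0) (b := t) hΦc (fun x _ => (hΦder x).hasDerivWithinAt)
    (by simp only [hΦ, integral_same, mul_zero, add_zero, Real.norm_eq_abs, abs_of_nonneg hA0]; exact le_rfl)
    (fun x hx => by
      have hxI : x ∈ Icc (0:ℝ) t := ⟨hx.1, hx.2.le⟩
      have hGxx : Gx x = G x := hGx_eq x ⟨hx.1, (hx.2.trans htτ).le⟩
      have h1 := hGΦ x hxI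
      have h0 := hG0 x hxI
      have hΦ0 : 0 ≤ Φ x := h0.trans h1
      rw [Real.norm_eq_abs, Real.norm_eq_abs, abs_of_nonneg hΦ0, hGxx, abs_of_nonneg (mul_nonneg cG_nonneg h0),
        add_zero]
      exact mul_le_mul_of_nonneg_left h1 cG_nonneg)
  have hfin := hgr t ⟨ht0, le_rfl⟩
  rw [gronwallBound_ε0, sub_zero, Real.norm_eq_abs] at hfin
  have hΦt : G t ≤ A * Real.exp (cG * t) := by
    have h1 := hGΦ t ⟨ht0, le_rfl⟩
    exact h1.trans ((le_abs_self _).trans hfin)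
  -- e^{ct} ≤ 1 + 2^{-18}
  have hexp : Real.exp (cG * t) ≤ 1 + 1 / 2 ^ 18 :=
    (Real.exp_le_exp.2 (mul_le_mul_of_nonneg_left htT cG_nonneg)).trans exp_cG_le
  calc F (blockMode i) 2 t = G t := rfl
    _ ≤ A * Real.exp (cG * t) := hΦt
    _ ≤ A * (1 + 1 / 2 ^ 18) := mul_le_mul_of_nonneg_left hexp hA0
    _ = (F₀ (blockMode i) 2 + M ^ 2 / 2) * (1 + 1 / 2 ^ 18) := by rw [hA]

end Summit.NavierStokesRegularity.NavierStokesRegularity.Cruxes.RelayFrontStep.PhaseI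

end
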